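import Summits.BirchSwinnertonDyer.BirchSwinnertonDyer.Theorems.SignedLowerHalvesKobayashiLowerHalfSemistableScopeReduction
import Literature.NumberTheory.QuadraticFields.ImaginaryQuadraticPrescribedSplittingInert
import HarnessLib

/-!
# Route `SignedLowerHalves`, crux `KobayashiLowerHalfSemistable` (item stmt-BirchSwinnertonDyer-19000): the auxiliary
# (ram) prime AND the auxiliary imaginary quadratic field of BSTW II §2.3 (S1 ∧ S2 + G3) exist for EVERY semistable
# curve at EVERY odd good supersingular prime — class-wide, no class-number condition — and what the crux then costs
# (cell `bsd-ssimc`, seat `bsd-ssimc-bstw` gen 9; a `--supports … --as helper` file; THEOREMS ONLY; closes nothing)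

PARTITION (cell bsd-ssimc, D-0054): X6 ∧ r = 0 (A6) × 13 (+10~) × p ≥ 5 + X6 r1 + literal row D2 @ p ≥ 5 —
types-the-object-of (the class-number-FREE part S1 ∧ S2 of the scope witness of the cell-verified reading of BSTW
Thm 1.3 is a THEOREM class-wide; the (α) rider `p ∤ h_L` is isolated as ONE displayed corner hypothesis); closes NONE.
HONEST FRAMING: nothing here proves Kobayashi's conjecture for any curve; the binders
`BurungaleSkinnerTianWan2024_thm13_scoped_OPEN` / `…_scopedAtThree_OPEN` transcribe an UNREFEREED preprint in the regime
the cell verified (REPORT-bstw-6 / -7) and enter ONLY as hypotheses; BSD is not proved by any of this; the item stays OPEN.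

## Context (why this file)

Gen 2 of seat k3-c2 (`…SemistableScopeReduction.lean`) reduced the scope witness `BSTWScope.HasWitness W p` of the
cell-verified reading (S1: a (ram) prime `q`; S2 + G3: an auxiliary imaginary quadratic `L` with `p` split, `q` inert,
`N/q` split, `2` split if good, `(d_L, 2N) = 1`; (α): `p ∤ h_L`) to the displayed class-number statement CL(p) — OPEN IN
PRINT at every `p ≥ 5` because of its clause `p ∤ h_L` (Wiles 2015 / Beckwith–Raum–Richter 2024 / Bruinier 1999 each
miss one local condition). This file separates the two halves:

* the CLASS-NUMBER-FREE half S1 ∧ S2 is a THEOREM for every `W`, `p` with a (ram) prime (`BSTWScope_exists_auxField_of_ram`,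
  from the Literature theorem `Quadratic.exists_imaginaryQuadratic_split_inert'` = Dirichlet + CRT + decomposition law,
  `Literature/NumberTheory/QuadraticFields/ImaginaryQuadraticPrescribedSplittingInert.lean`), hence class-wide on X6 at
  every odd `p` modulo modularity + Diamond/Ribet level-lowering by name (`BSTWScope_exists_auxField_of_goodSS`);
* the rider (α) is then EXACTLY the displayed corner hypothesis `hα` of
  `KobayashiLowerHalfSemistable_of_tiers_of_hLCorner`: «the cell-verified reading also covers the pairs `(E, p)` all of
  whose admissible auxiliary fields have `p ∣ h_L`». Seat bstw's MEMO-9 (HOME/bstw-MEMO-9.md) argues that this corner is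
  ALREADY inside the verified chain (the one `h_L`-sensitive point of record, bstw-MEMO-6 B.1's bracketed «finite-index
  variant» needing C.2(ii) = Rohrlich 1989, never occurs: `Γ_L = Γ_L^cyc × Γ_L^v` for every `L`, bstw-MEMO-4 Lemma I(ii));
  that is a REFEREE matter (REPORT-bstw-9). The kernel form of «the verified reading WITHOUT (α)» is the INLINE
  hypothesis `hS` of `KobayashiLowerHalfSemistable_of_scopeS_of_tiers` (no new binder is defined here): it is implied by
  the printed claim (`scopeS_of_thm13_OPEN`) and implies the (α)-scoped binder (`thm13_scoped_OPEN_of_scopeS`).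

So, on bstw-MEMO-9's reading, the crux BY NAME costs: ONE displayed PRE claim at `p ≥ 5` (S-scope) + the `p = 3` tier
binder (PRE on (3-ii)♭) + three PUBLISHED facts (modularity, Diamond 1995 / Ribet 1990, Bhargava–Varma 2016) — and NO
class-number statement. Nothing is booked or moved by this file.

References: [BurungaleSkinnerTianWan2024] Thm. 1.3, Part II §2.3 (PRE); [Kobayashi2003] Conjecture (p. 2);
[SkinnerUrban2014] Thm. 2 (ram); [Ribet1990] Thm. 1.1; [Diamond1995RefinedSerre] Thm. 1.1; [BhargavaVarma2016] Cor. 4 (a);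
[Marcus2018] Ch. 3 Thm. 25; [IrelandRosen1990] Ch. 16 Thm. 1; cell records REPORT-bstw-6 (7a95ba616d84dc36),
NOTE-W-ref-2, bstw-MEMO-4 Part A (Lemma I), bstw-MEMO-6 B.1/C.2, bstw-MEMO-9.
-/

set_option autoImplicit false
set_option linter.dupNamespace false

noncomputable section

open scoped Classical

open WeierstrassCurve NumberField Literature.NumberTheory.EllipticCurves
  Literature.NumberTheory.EllipticCurves.ModularForms
  Literature.NumberTheory.EllipticCurves.Rank1Residual
  Literature.NumberTheory.EllipticCurves.Rank1Residual.Typed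
  Literature.NumberTheory.QuadraticFields
  Summit.BirchSwinnertonDyer.Rank1Residual.Supersingular

namespace Summit.BirchSwinnertonDyer.BirchSwinnertonDyer.Theorems

/-! ### S1 ∧ S2 (+ G3) WITHOUT (α): a theorem for every `W`, `p` with a (ram) prime -/

/-- **The auxiliary (ram) prime and the auxiliary field of BSTW II §2.3, class-number-free, from a (ram) prime, at
ANY prime `p`.** Given a multiplicative prime `q ≠ p` with `p ∤ ord_q(Δ_min)` (`hram : Rank1Residual.Ram W p` = S1),
the Literature theorem `Quadratic.exists_imaginaryQuadratic_split_inert'` (Dirichlet + CRT + decomposition law) with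
`S = ({p, 2} ∪ {ℓ ∣ Δ_min}) ∖ {q}` (split) and `T = {q}` (inert) returns an imaginary quadratic `L` with `p` split,
`q` inert and unramified, every other bad prime split and unramified, `2` split (or `2 = q` inert, then `2` is bad and
G3 is vacuous), so `(d_L, 2N) = 1`: this is `BSTWScope.IsAuxiliaryField W p q L` (S2 + G3). NO condition on `h_L`.
The k3-c2 proof of `BSTWScope_hasWitness_of_existsAuxField_of_ram`, verbatim, with the hypothesis CL(p) replaced by
the theorem. UNCONDITIONAL; closes nothing.
[cite: SkinnerUrban2014, Thm. 2 (p. 3), second bullet (shape of (ram) only)]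
[cite: Marcus2018, Ch. 3 Thm. 25 (decomposition law)] [cite: IrelandRosen1990, Ch. 16 §1 Thm. 1 (Dirichlet)] -/
theorem BSTWScope_exists_auxField_of_ram (W : WeierstrassCurve ℚ) [W.IsElliptic] [W.IsGloballyMinimal]
    (p : ℕ) [Fact p.Prime] (hram : Ram W p) :
    ∃ (q : ℕ) (_ : Fact q.Prime) (L : Type) (_ : Field L) (_ : NumberField L),
      BSTWScope.IsAuxiliaryPrime W p q ∧ BSTWScope.IsAuxiliaryField W p q L := by
  obtain ⟨q, hqF, hqp, hmult, hord⟩ := hram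
  have hqP : q.Prime := hqF.out
  have hpP : p.Prime := Fact.out
  set B : Finset ℕ := (minimalDiscriminantInt W).natAbs.primeFactors with hB
  set S : Finset ℕ := (insert p (insert 2 B)).erase q with hS
  have hSprime : ∀ p' ∈ S, p'.Prime := by
    intro p' hp'
    rcases Finset.mem_insert.mp (Finset.mem_of_mem_erase hp') with rfl | hp''
    · exact hpP
    rcases Finset.mem_insert.mp hp'' with rfl | hp'''
    · norm_num
    exact Nat.prime_of_mem_primeFactors hp'''
  have hdisj : Disjoint S {q} := by
    rw [Finset.disjoint_singleton_right]
    exact Finset.notMem_erase q _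
  obtain ⟨L, _instF, _instN, h2, hneg, hSsplit, hTinert⟩ :=
    Quadratic.exists_imaginaryQuadratic_split_inert' S {q} hSprime (by simpa using hqP) hdisj
  have hqT : q ∈ ({q} : Finset ℕ) := Finset.mem_singleton_self q
  have hbadB : ∀ ℓ : ℕ, (hℓ : ℓ.Prime) →
      (haveI : Fact ℓ.Prime := ⟨hℓ⟩; ¬ W.HasGoodReductionAtPrime ℓ) → ℓ ∈ B := by
    intro ℓ hℓ hbad
    haveI : Fact ℓ.Prime := ⟨hℓ⟩
    have hd := natCast_dvd_minimalDiscriminantInt_of_not_hasGoodReductionAtPrime (W := W) ℓ hbad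
    rw [hB, Nat.mem_primeFactors]
    refine ⟨hℓ, ?_, Int.natAbs_ne_zero.mpr (minimalDiscriminantInt_ne_zero W)⟩
    have := Int.natAbs_dvd_natAbs.mpr hd
    simpa using this
  have hmemS : ∀ ℓ : ℕ, ℓ ≠ q → (ℓ = p ∨ ℓ = 2 ∨ ℓ ∈ B) → ℓ ∈ S := by
    intro ℓ hℓq h
    rw [hS, Finset.mem_erase]
    refine ⟨hℓq, ?_⟩
    rcases h with rfl | rfl | h
    · exact Finset.mem_insert_self _ _
    · exact Finset.mem_insert_of_mem (Finset.mem_insert_self _ _)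
    · exact Finset.mem_insert_of_mem (Finset.mem_insert_of_mem h)
  refine ⟨q, hqF, L, _instF, _instN, ⟨hqp, hmult, hord⟩, ⟨?_, ?_, ?_, ?_, ?_, ?_, ?_⟩⟩
  · exact (isImaginaryQuadratic_iff_discr_neg).mpr ⟨h2, hneg⟩
  · exact (hSsplit p (hmemS p (Ne.symm hqp) (Or.inl rfl))).2
  · exact (hTinert q hqT).2
  · intro ℓ hℓ hℓq hbad
    exact (hSsplit ℓ (hmemS ℓ hℓq (Or.inr (Or.inr (hbadB ℓ hℓ hbad))))).2
  · by_cases h2q : (2 : ℕ) = q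
    · have := (hTinert q hqT).1
      rw [← h2q] at this
      exact_mod_cast this
    · exact_mod_cast (hSsplit 2 (hmemS 2 h2q (Or.inr (Or.inl rfl)))).1
  · intro ℓ hℓ hbad
    by_cases hℓq : ℓ = q
    · subst hℓq; exact (hTinert ℓ hqT).1
    · exact (hSsplit ℓ (hmemS ℓ hℓq (Or.inr (Or.inr (hbadB ℓ hℓ hbad))))).1
  · intro hgood2
    by_cases h2q : (2 : ℕ) = q
    · subst h2q
      exact absurd hgood2 (not_hasGoodReductionAtPrime_of_hasMultiplicativeReductionAtPrime 2 hmult)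
    · exact_mod_cast (hSsplit 2 (hmemS 2 h2q (Or.inr (Or.inl rfl)))).2

/-- **S1 ∧ S2 (+ G3) CLASS-WIDE on X6: at ANY odd prime `p`, for every semistable `E` with good supersingular
reduction at `p`, the (ram) prime and the class-number-free auxiliary field exist** — the (ram) prime from Ribet's
weight-2 level-lowering (`SkinnerUrban2014.ram_of_semistable_of_irr`, modulo modularity `hmod` and `hLL` = Diamond 1995
Thm 1.1 / Ribet 1990 Thm 1.1, published, by name; `E[p]` irreducible from supersingularity), the field from
`BSTWScope_exists_auxField_of_ram`. So the scope witness `BSTWScope.HasWitness W p` minus its rider (α) `p ∤ h_L` is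
FREE class-wide: on X6 the (α) rider is the ONLY non-published content of the witness. Closes nothing.
[cite: Ribet1990, Thm. 1.1] [cite: Diamond1995RefinedSerre, Thm. 1.1]
[cite: SkinnerUrban2014, remark before Cor. 3.6.10 (p. 45)] -/
theorem BSTWScope_exists_auxField_of_goodSS (hmod : exists_isNewformOf)
    (hLL : Literature.NumberTheory.Automorphic.diamond1995_refinedSerre)
    (W : WeierstrassCurve ℚ) [W.IsElliptic] [W.IsGloballyMinimal] (p : ℕ) [Fact p.Prime] (hp2 : p ≠ 2)
    (hsst : Semistable W) (hss : GoodSS W p) :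
    ∃ (q : ℕ) (_ : Fact q.Prime) (L : Type) (_ : Field L) (_ : NumberField L),
      BSTWScope.IsAuxiliaryPrime W p q ∧ BSTWScope.IsAuxiliaryField W p q L := by
  have hirr : Irr W p :=
    hasIrreducibleModPGaloisRep_of_dvd_frobeniusTrace W p hp2
      (W.not_dvd_minimalDiscriminantInt_of_hasGoodReductionAtPrime' p hss.1) hss.2
  exact BSTWScope_exists_auxField_of_ram W p
    (Literature.NumberTheory.EllipticCurves.SkinnerUrban2014.ram_of_semistable_of_irr hmod hLL W p hp2 hss.1
      hsst hirr)

/-- **A scope witness from S1 ∧ S2 and a class-number fact for ONE field.** If some class-number-free auxiliary pair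
`(q, L)` happens to have `p ∤ h_L`, it is a full witness. (Trivial repackaging; recorded so that per-class bookings
can cite the S1 ∧ S2 theorem plus one computed class number.) Closes nothing.
[cite: SkinnerUrban2014, Thm. 2 (p. 3), second bullet (shape of (ram) only)] -/
theorem BSTWScope_hasWitness_of_auxField_of_not_dvd_classNumber (W : WeierstrassCurve ℚ) [W.IsElliptic]
    [W.IsGloballyMinimal] (p : ℕ) [Fact p.Prime] {q : ℕ} [hq : Fact q.Prime] {L : Type} [Field L] [NumberField L]
    (haux : BSTWScope.IsAuxiliaryPrime W p q) (hfield : BSTWScope.IsAuxiliaryField W p q L)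
    (hh : ¬ p ∣ NumberField.classNumber L) : BSTWScope.HasWitness W p :=
  ⟨q, hq, L, inferInstance, inferInstance, haux, hfield, hh⟩

/-! ### The crux BY NAME when the verified reading carries NO class-number rider (inline S-scope; no new binder) -/

/-- **The crux BY NAME from the S-SCOPED reading at `p ≥ 5` (displayed INLINE as `hS`), the `p = 3` tier binder, and
three PUBLISHED facts — NO class-number statement.** `hS` is the cell-verified reading of BSTW Thm 1.3 at `p ≥ 5` with
the scope S1 ∧ S2 only (a (ram) prime and a class-number-free auxiliary field): strictly between the printed claim
(`scopeS_of_thm13_OPEN`) and the (α)-scoped binder of record (`thm13_scoped_OPEN_of_scopeS`). Since S1 ∧ S2 is free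
class-wide on X6 (`BSTWScope_exists_auxField_of_goodSS`), `hS` + the `p = 3` tier (`…_scopedAtThree_OPEN`, PRE on
(3-ii)♭, witness free at 3 by Bhargava–Varma) + modularity + Diamond/Ribet give `KobayashiLowerHalfSemistable`.
Whether `hS` IS the cell's verified reading (i.e. whether the (α) rider of NOTE-W-ref-2 is void) is argued in
bstw-MEMO-9 and is the referee's to grade; here `hS` is a displayed hypothesis, nothing more. CONDITIONAL
(`conditional-result`); the item stays OPEN. [claim: BurungaleSkinnerTianWan2024, status: under-review]
[cite: Kobayashi2003, Conjecture (Main Conjecture) (p. 2)] [cite: BhargavaVarma2016, Cor. 4 (a) (p. 237)]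
[cite: Ribet1990, Thm. 1.1] [cite: Diamond1995RefinedSerre, Thm. 1.1] -/
theorem KobayashiLowerHalfSemistable_of_scopeS_of_tiers
    (hS : ∀ (W : WeierstrassCurve ℚ) [W.IsElliptic] [W.IsGloballyMinimal] (p : ℕ) [Fact p.Prime],
      5 ≤ p → Semistable W → GoodSS W p →
      (∃ (q : ℕ) (_ : Fact q.Prime) (L : Type) (_ : Field L) (_ : NumberField L),
        BSTWScope.IsAuxiliaryPrime W p q ∧ BSTWScope.IsAuxiliaryField W p q L) →
      ∀ ε : ℤˣ, KobayashiMainConjecture W p ε)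
    (hBSTW3 : BurungaleSkinnerTianWan2024_thm13_scopedAtThree_OPEN) (hmod : exists_isNewformOf)
    (hLL : Literature.NumberTheory.Automorphic.diamond1995_refinedSerre)
    (hBV : bhargavaVarma2016_exists_imaginaryQuadratic_split_inert_three_not_dvd_classNumber) :
    Summit.BirchSwinnertonDyer.BirchSwinnertonDyer.Theses.SignedLowerHalves.KobayashiLowerHalfSemistable := by
  intro W _ _ p hpF hp hX
  by_cases h5 : 5 ≤ p
  · have hw := BSTWScope_exists_auxField_of_goodSS hmod hLL W p hp hX.2.1 hX.1
    exact ⟨1, kobayashiLowerDivisibility_of_mainConjecture (hS W p h5 hX.2.1 hX.1 hw 1)⟩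
  · have h2 := hpF.out.two_le
    have hlt : p < 5 := Nat.lt_of_not_le h5
    interval_cases p
    · exact absurd rfl hp
    · exact stub_three_of_thm13_scopedAtThree_OPEN_of_published hBSTW3 hmod hLL hBV W hX
    · exact absurd hpF.out (by decide)

/-- The S-scoped reading is IMPLIED by the printed claim (BSTW Thm 1.3 as printed, `…thm13_OPEN`): it only adds
hypotheses. Sanity check that `hS` above is never stronger than taking the preprint's theorem.
[claim: BurungaleSkinnerTianWan2024, status: under-review] -/
theorem scopeS_of_thm13_OPEN (h : BurungaleSkinnerTianWan2024_thm13_OPEN) :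
    ∀ (W : WeierstrassCurve ℚ) [W.IsElliptic] [W.IsGloballyMinimal] (p : ℕ) [Fact p.Prime],
      5 ≤ p → Semistable W → GoodSS W p →
      (∃ (q : ℕ) (_ : Fact q.Prime) (L : Type) (_ : Field L) (_ : NumberField L),
        BSTWScope.IsAuxiliaryPrime W p q ∧ BSTWScope.IsAuxiliaryField W p q L) →
      ∀ ε : ℤˣ, KobayashiMainConjecture W p ε := by
  intro W _ _ p _ h5 hsst hss _ ε
  exact h W p (by omega) hsst hss (fun h3 => by omega) ε

/-- The S-scoped reading IMPLIES the (α)-scoped binder of record (`…thm13_scoped_OPEN`): a scope witness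
`BSTWScope.HasWitness W p` contains a class-number-free auxiliary pair. So the S-scope sits between the printed claim
and the cell's binder of record. [claim: BurungaleSkinnerTianWan2024, status: under-review] -/
theorem thm13_scoped_OPEN_of_scopeS
    (hS : ∀ (W : WeierstrassCurve ℚ) [W.IsElliptic] [W.IsGloballyMinimal] (p : ℕ) [Fact p.Prime],
      5 ≤ p → Semistable W → GoodSS W p →
      (∃ (q : ℕ) (_ : Fact q.Prime) (L : Type) (_ : Field L) (_ : NumberField L),
        BSTWScope.IsAuxiliaryPrime W p q ∧ BSTWScope.IsAuxiliaryField W p q L) →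
      ∀ ε : ℤˣ, KobayashiMainConjecture W p ε) :
    BurungaleSkinnerTianWan2024_thm13_scoped_OPEN := by
  intro W _ _ p _ h5 hsst hss hw ε
  obtain ⟨q, hq, L, hF, hN, haux, hfield, _⟩ := hw
  exact hS W p h5 hsst hss ⟨q, hq, L, hF, hN, haux, hfield⟩ ε

/-! ### The (α) rider ISOLATED: the crux from the binder of record + ONE displayed corner hypothesis -/

/-- **The crux BY NAME from the (α)-scoped binder OF RECORD, the `p ∣ h_L` CORNER displayed as ONE hypothesis `hα`,
the `p = 3` tier and three PUBLISHED facts.** `hα` says: at `p ≥ 5`, for a semistable `E` supersingular at `p` ALL of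
whose class-number-free auxiliary pairs `(q, L)` (which exist, `BSTWScope_exists_auxField_of_goodSS`) have `p ∣ h_L`,
Kobayashi's main conjecture still holds — the exact content of NOTE-W-ref-2's rider (α) («a booked class is covered by
the PASS as issued iff S2's auxiliary `L` can be taken with `p ∤ h_L`»). For every OTHER pair the binder of record
applies. This replaces the class-number statement CL(p) of `KobayashiLowerHalfSemistable_of_tiers_of_classNumberHypothesis`
(OPEN in print) by the narrower claim `hα` about the PRE source's own argument, which bstw-MEMO-9 submits to the
referee as ALREADY VERIFIED (Γ_L = Γ_L^cyc × Γ_L^v for every `L`; the Rohrlich-1989 clause is never invoked).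
CONDITIONAL (`conditional-result`); the item stays OPEN. [claim: BurungaleSkinnerTianWan2024, status: under-review]
[cite: Kobayashi2003, Conjecture (Main Conjecture) (p. 2)] [cite: BhargavaVarma2016, Cor. 4 (a) (p. 237)]
[cite: Ribet1990, Thm. 1.1] -/
theorem KobayashiLowerHalfSemistable_of_tiers_of_hLCorner
    (hBSTW5 : BurungaleSkinnerTianWan2024_thm13_scoped_OPEN)
    (hα : ∀ (W : WeierstrassCurve ℚ) [W.IsElliptic] [W.IsGloballyMinimal] (p : ℕ) [Fact p.Prime],
      5 ≤ p → Semistable W → GoodSS W p →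
      (∀ (q : ℕ) (_ : Fact q.Prime) (L : Type) (_ : Field L) (_ : NumberField L),
        BSTWScope.IsAuxiliaryPrime W p q → BSTWScope.IsAuxiliaryField W p q L →
          p ∣ NumberField.classNumber L) →
      ∀ ε : ℤˣ, KobayashiMainConjecture W p ε)
    (hBSTW3 : BurungaleSkinnerTianWan2024_thm13_scopedAtThree_OPEN) (hmod : exists_isNewformOf)
    (hLL : Literature.NumberTheory.Automorphic.diamond1995_refinedSerre)
    (hBV : bhargavaVarma2016_exists_imaginaryQuadratic_split_inert_three_not_dvd_classNumber) :
    Summit.BirchSwinnertonDyer.BirchSwinnertonDyer.Theses.SignedLowerHalves.KobayashiLowerHalfSemistable := by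
  refine KobayashiLowerHalfSemistable_of_scopeS_of_tiers ?_ hBSTW3 hmod hLL hBV
  intro W _ _ p _ h5 hsst hss _ ε
  by_cases hw : BSTWScope.HasWitness W p
  · exact hBSTW5 W p h5 hsst hss hw ε
  · refine hα W p h5 hsst hss (fun q hq L hF hN haux hfield => ?_) ε
    by_contra hndvd
    exact hw ⟨q, hq, L, hF, hN, haux, hfield, hndvd⟩

end Summit.BirchSwinnertonDyer.BirchSwinnertonDyer.Theorems

end
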